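import Summits.BirchSwinnertonDyer.Rank1Residual.Additive.GoodModelReductionDatum
import Summits.BirchSwinnertonDyer.Rank1Residual.X2.GreenbergVatsalSelmerLink
import HarnessLib

/-!
# 'Kummer ⊆ Greenberg' for the good-model datum at every LEVEL whose local Galois group fixes the
# model — row T-RD-E346 file K2 (cell `b2b-bsdres`, team n1011; seat n1011-p05 gen 6)

HONEST FRAMING (cell `b2b-bsdres`, run/shared/lean/b2b/bsd-rank1-residual/, verbatim in every
file): the goal of the cell is to DELETE the COMBINATION-SHAPED residual classes of the
Birch–Swinnerton-Dyer formula for ALL analytic-rank `≤ 1` elliptic curves over `ℚ` — "full BSD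
formula for every rank `≤ 1` curve in class `C`" assembled STRICTLY from published theorems — so
that the rank-`≤ 1` remainder becomes exactly the CONSTRUCTION-SHAPED classes, which are TYPED
(missing-input `Prop`s), NOT attempted. This is not "finishing BSD". Team n1011 (X4 ∧ `p = 3`,
§I N10/N11; Route G δ-input on the `(G-ord)` rows with `e ∈ {3,4,6}`): research route; TOOL theorems
of Galois cohomology, ALL UNCONDITIONAL (no named fact enters this file); no definition, no named
fact; nothing booked; no label changes.

## What

* §1 (any number field `K`, any `E/K`, any Greenberg datum `N` at `v`, any level `H ≤ Γ_K`)
  `localKerOver_le_greenbergKer_of_level` — X2's THEOREM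
  `GreenbergVatsalSelmerLink.localKerOver_le_greenbergKer` ("the classical condition implies
  Greenberg's condition at `v ∣ p`", Greenberg LNM 1716 §2 pp. 69–70) with its KUMMER COMPATIBILITY
  `hN` ("`σP − P ∈ M⁺_v` for inertial `σ`") demanded ONLY of the inertial `σ ∈ Γ_{K_v}` whose
  restriction to `Γ_K` lies IN THE LEVEL `H` — X2's proof uses nothing more (the cocycle is
  evaluated at `H ⊓ I_v`). This is the form needed by an ADDITIVE curve, for which the compatibility
  fails at the full inertia group (cf. p05 F7a `KummerLeGreenbergTwistLevel`, module docstring: at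
  `ker κ` the hypothesis of X2's lemma is FALSE for the twisted datum).
* §2 (`K = ℚ`, the good-model datum of T-ROL-G F-A2: `E/ℚ` elliptic, `v ∋ p`,
  `W₀ = C • E ⊗ K̄_v` over the valuation ring of the spectral valuation, `red = red_{W₀} ∘ Φ_C`,
  `Lv.plus = E[p^∞] ∩ ker red`) `smul_sub_mem_plus_of_map_eq` — an INERTIAL `σ` FIXING `C` has
  `σP − P ∈ ker red` for every `P ∈ E(K̄_v)` (F-A1 `goodReductionHom_pointEquiv_map_eq_of_map_eq`:
  an inertial isometry fixing the good model does not change reductions; Silverman VII.2.1 for the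
  model over the fixed field of `σ`); hence `localKerOver_le_greenbergKer_of_goodModel_of_level`:
  for every `H ≤ Γ_ℚ` whose local group at `v` FIXES `C` (cc-typer-2's S2 currency `hHC`),
  `W.localKerOver p H ℚ_v ≤ Lv.greenbergKer H`.

Consumer: K4 `GoodModelGreenbergKummerIdentification` at the level `H = ker κ ⊓ U`, `U` the
prime-to-`p` normal fixing level of K1 `PrimeToPFixingLevel`.

References: R. Greenberg, LNM 1716 (1999) §2 pp. 69–70 (`Sel_E(F_∞)_p ⊆ S_A(F_∞)`: `Im κ_η ⊆`
Greenberg's condition at `η ∣ p`) [GreenbergLNM1716]; R. Greenberg, V. Vatsal, Invent. Math. 142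
(2000) §2 p. 19 (6) [GreenbergVatsal2000]; J.-P. Serre, J. Tate, Ann. of Math. 88 (1968) §2 Thm. 2
[SerreTate1968]; J. H. Silverman, *AEC* 2nd ed. VII.2.1 [SilvermanAEC2009]; skeleton
`cells/n1011/skel/T-RD-E346.md` (f88cc66b311ca16d).
-/

noncomputable section

open scoped Classical NNReal

open WeierstrassCurve

universe u

namespace Summit.BirchSwinnertonDyer.Rank1Residual.Additive.GoodModelLine

open NumberField IsDedekindDomain Field IsDedekindDomain.HeightOneSpectrum
  Literature.NumberTheory.GaloisRepresentations Literature.NumberTheory.EllipticCurves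
  Literature.NumberTheory.EllipticCurves.GreenbergSelmer
  Summit.BirchSwinnertonDyer.Rank1Residual.X2.GreenbergVatsalReductionDatum
  Summit.BirchSwinnertonDyer.Rank1Residual.X2.GreenbergVatsalSelmerLink

/-! ## §1 X2's 'classical ⊆ Greenberg at `v ∣ p`' with the Kummer compatibility asked only on the
level -/

section Level

variable {K : Type u} [Field K] [NumberField K] (W : WeierstrassCurve K) (p : ℕ)
  (H : Subgroup (absoluteGaloisGroup K))

/-- **The classical condition implies Greenberg's condition at `v ∣ p`, for data satisfying the
Kummer compatibility ON THE LEVEL `H`**: if every torsion point `σP − P` with `σ ∈ I_{K_v}`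
inertial AND `res σ ∈ H`, `P ∈ E(K̄_v)`, lies in `M⁺_v = N.plus`, then every class of
`H¹(H, E[p^∞])` dying in `H¹(H_{K_v}, E(K̄_v))` dies in `H¹(H ⊓ I_v, E[p^∞]/M⁺_v)`. (X2's
`localKerOver_le_greenbergKer`, proof verbatim: it evaluates the cocycle only at `H ⊓ I_v`.)
[cite: GreenbergLNM1716, §2 pp. 69–70 (Sel_E ⊆ S_A)] -/
theorem localKerOver_le_greenbergKer_of_level {v : HeightOneSpectrum (𝓞 K)}
    (N : LocalDatum K (W.geomPrimaryTorsion p) v)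
    (hN : ∀ σ ∈ absInertia (v.adicCompletion K),
      absGaloisRestrict K (v.adicCompletion K) σ ∈ H →
      ∀ (P : localPoints W (v.adicCompletion K)) (m : W.geomPrimaryTorsion p),
        pointsMap W (v.adicCompletion K) (m : W.geomPoints) = σ • P - P → m ∈ N.plus) :
    W.localKerOver p H (v.adicCompletion K) ≤ N.greenbergKer H := by
  intro c hc
  obtain ⟨f, rfl⟩ := oneCocycleClass_surjective (discreteTopRep H (W.geomPrimaryTorsion p)) c
  obtain ⟨P, hP⟩ := (oneCocycleClass_mem_localKerOver_iff W p H _ f).1 hc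
  refine oneCocycleClass_mem_greenbergKer_of_forall_mem H _ N f fun x ↦ ?_
  obtain ⟨hxH, hxI⟩ := (mem_inertiaIn_iff H v x.1).1 x.2
  obtain ⟨σ, hσI, hσx⟩ := Subgroup.mem_map.1 hxI
  have hσx' : absGaloisRestrict K (v.adicCompletion K) σ =
      ((x : decomp (K := K) v) : absoluteGaloisGroup K) := hσx
  have hσHres : absGaloisRestrict K (v.adicCompletion K) σ ∈ H := by rw [hσx']; exact hxH
  have hσH : σ ∈ localSubgroup H (v.adicCompletion K) :=
    mem_localSubgroup_of_absGaloisRestrict_mem H hσHres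
  have hres : resGalSubgroup H (v.adicCompletion K) ⟨σ, hσH⟩ = inertiaInToH H v x :=
    Subtype.ext hσx'
  have key := hP ⟨σ, hσH⟩
  rw [hres] at key
  exact hN σ hσI hσHres P _ key

end Level

/-! ## §2 The good-model datum: an inertial isometry fixing `C` does not change reductions -/

section GoodModel

variable (W : WeierstrassCurve ℚ) [W.IsElliptic] (p : ℕ) [hp : Fact p.Prime]
  {v : HeightOneSpectrum (𝓞 ℚ)}
  {C : VariableChange (AlgebraicClosure (v.adicCompletion ℚ))}
  {W₀ : WeierstrassCurve (specVal v).integer}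
  (hW₀ : C • (W.baseChange (v.adicCompletion ℚ)).baseChange (AlgebraicClosure (v.adicCompletion ℚ)) =
    W₀.baseChange (AlgebraicClosure (v.adicCompletion ℚ)))
  (hΔ : IsUnit W₀.Δ)
  (red : localPoints W (v.adicCompletion ℚ) →+
    (W₀.map (IsLocalRing.residue (specVal v).integer)).toAffine.Point)
  (hred : ∀ P, red P = goodReductionHom W₀ (Valuation.integer.integers (specVal v)) hΔ
    (Affine.Point.congrEquiv hW₀ (VariableChange.pointEquiv _ C
      (Affine.Point.congrEquiv (baseChange_baseChange_adicCompletion W v).symm P))))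
  (Lv : LocalDatum ℚ (W.geomPrimaryTorsion p) v)
  (hLv : ∀ m, m ∈ Lv.plus ↔ red (pointsMap W (v.adicCompletion ℚ) (m : W.geomPoints)) = 0)

omit [W.IsElliptic] hp in
include hred in
/-- **An inertial `σ` FIXING `C` does not change reductions**: `red(σP) = red(P)` for every
`P ∈ E(K̄_v)` (`red = red_{W₀} ∘ Φ_C`; F-A1 `goodReductionHom_pointEquiv_map_eq_of_map_eq` — the
coordinates of `Φ_C(σP) = σ(Φ_C P)` are the `σ`-conjugates of those of `Φ_C P`, congruent to them
modulo `𝔪_w`). [cite: SilvermanAEC2009, Prop. VII.2.1] [cite: SerreTate1968, §2 Thm. 2 (mechanism of proof)] -/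
theorem red_smul_eq_of_map_eq {σ : absoluteGaloisGroup (v.adicCompletion ℚ)}
    (hσ : σ ∈ absInertia (v.adicCompletion ℚ))
    (hC : C.map ((absoluteGaloisGroup.toAlgEquiv (v.adicCompletion ℚ) σ :
        AlgebraicClosure (v.adicCompletion ℚ) ≃ₐ[v.adicCompletion ℚ]
          AlgebraicClosure (v.adicCompletion ℚ)) :
        AlgebraicClosure (v.adicCompletion ℚ) →+* AlgebraicClosure (v.adicCompletion ℚ)) = C)
    (P : localPoints W (v.adicCompletion ℚ)) : red (σ • P) = red P := by
  obtain ⟨𝔐, h𝔐⟩ := v.localPrimesAbove_nonempty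
  have hσI' : σ ∈ 𝔐.inertia (absoluteGaloisGroup (v.adicCompletion ℚ)) := by
    rw [inertia_eq_absInertia (specVal_spec v) h𝔐]; exact hσ
  have hmove := (mem_inertia_iff_spectralValuation (specVal_spec v) h𝔐).1 hσI'
  rw [hred, hred, congrEquiv_smul W v σ]
  exact goodReductionHom_pointEquiv_map_eq_of_map_eq (W.baseChange (v.adicCompletion ℚ)) C hW₀ hΔ
    (absoluteGaloisGroup.toAlgEquiv _ σ) (fun z ↦ spectralValuation_smul (specVal_spec v) σ z)
    hmove hC P

omit [W.IsElliptic] hp in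
include hred hLv in
/-- **Kummer compatibility of the good-model datum at an inertial `σ` fixing `C`**: every
`p`-power torsion point of the form `σP − P` lies in `C = E[p^∞] ∩ ker(red_{W₀} ∘ Φ_C)`.
[cite: GreenbergLNM1716, §2 p. 73 (C_v = ker(E[p^∞] → Ẽ[p^∞]))] [cite: SilvermanAEC2009, Prop. VII.2.1] -/
theorem smul_sub_mem_plus_of_map_eq {σ : absoluteGaloisGroup (v.adicCompletion ℚ)}
    (hσ : σ ∈ absInertia (v.adicCompletion ℚ))
    (hC : C.map ((absoluteGaloisGroup.toAlgEquiv (v.adicCompletion ℚ) σ :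
        AlgebraicClosure (v.adicCompletion ℚ) ≃ₐ[v.adicCompletion ℚ]
          AlgebraicClosure (v.adicCompletion ℚ)) :
        AlgebraicClosure (v.adicCompletion ℚ) →+* AlgebraicClosure (v.adicCompletion ℚ)) = C)
    (P : localPoints W (v.adicCompletion ℚ)) (m : W.geomPrimaryTorsion p)
    (hm : pointsMap W (v.adicCompletion ℚ) (m : W.geomPoints) = σ • P - P) : m ∈ Lv.plus := by
  rw [hLv, hm, map_sub, sub_eq_zero]
  exact red_smul_eq_of_map_eq W hW₀ hΔ red hred hσ hC P

include hred hLv in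
omit [W.IsElliptic] hp in
/-- **'Kummer ⊆ Greenberg' for the good-model datum at every level whose local group FIXES `C`.**
For `E/ℚ` elliptic, `v ∋ p`, a good model `W₀ = C • E ⊗ K̄_v` with its datum
`Lv.plus = E[p^∞] ∩ ker(red_{W₀} ∘ Φ_C)`, and a subgroup `H ≤ Γ_ℚ` such that every `σ ∈ Γ_{ℚ_v}`
with `res σ ∈ H` fixes `C` (cc-typer-2's S2 binder `hHC`; e.g. `H ≤ U` for the prime-to-`p`
fixing level `U` of K1): `W.localKerOver p H ℚ_v ≤ Lv.greenbergKer H` — every class satisfying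
the Kummer condition at `v` satisfies Greenberg's (inertia) condition there. With S2
(`Im λ ⊆ Im κ`, the strict form of the converse) this is Greenberg's `Im κ_K = Im λ_K` for the
good model over the layer cut out by `H`. [cite: GreenbergLNM1716, §2 pp. 69–70 and Prop. 2.4 (pp. 74–75)]
[cite: GreenbergVatsal2000, §2 p. 19 (6)] -/
theorem localKerOver_le_greenbergKer_of_goodModel_of_level (H : Subgroup (absoluteGaloisGroup ℚ))
    (hHC : ∀ σ : absoluteGaloisGroup (v.adicCompletion ℚ),
      absGaloisRestrict ℚ (v.adicCompletion ℚ) σ ∈ H →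
        C.map ((absoluteGaloisGroup.toAlgEquiv (v.adicCompletion ℚ) σ :
          AlgebraicClosure (v.adicCompletion ℚ) ≃ₐ[v.adicCompletion ℚ]
            AlgebraicClosure (v.adicCompletion ℚ)) :
          AlgebraicClosure (v.adicCompletion ℚ) →+* AlgebraicClosure (v.adicCompletion ℚ)) = C) :
    W.localKerOver p H (v.adicCompletion ℚ) ≤ Lv.greenbergKer H :=
  localKerOver_le_greenbergKer_of_level W p H Lv fun _σ hσI hσH P m hm ↦
    smul_sub_mem_plus_of_map_eq W p hW₀ hΔ red hred Lv hLv hσI (hHC _ hσH) P m hm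

end GoodModel

end Summit.BirchSwinnertonDyer.Rank1Residual.Additive.GoodModelLine

end
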